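import Summits.ValiantsHypothesis.ValiantsHypothesis.Theorems.KPlusLogSqLawTropicalBTranspose
import Summits.ValiantsHypothesis.ValiantsHypothesis.Theorems.KPlusLogSqLawTropicalBSymmetry

/-!
# Route `KPlusLogSqLaw`, crux `TropicalB` — SYMMETRIC designs: dominant permutations are INVOLUTIONS

HONEST FRAMING.  Helper file toward the registered stubs `stub_tropThin` / `stub_tropFat` of
`Cruxes/TropicalB/Lines/birth.lean` (crux `Summit.ValiantsHypothesis.ValiantsHypothesis.Theses.KPlusLogSqLaw.TropicalB`,
ledger item `stmt-ValiantsHypothesis-19771`, route `KPlusLogSqLaw`, DRAFT; cell `pub-symmetroid`, seat `val-sym-trop-p1`,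
2026-08-26).  Nothing here proves any part of a stub; nothing asserts `TropicalB`, `KPlusLogSqLaw`, `MatrixDescartes`
or anything about `VP ≠ VNP`.

The route's REAL side concerns SYMMETRIC pencils (`RealRootLawAt`), whose tropical designs are symmetric:
`v b a l = v a b l`, `ε b a l = ε a b l`.  For such a design the transposed Leibniz term `(σ⁻¹, λ ∘ σ⁻¹)` has the same
weight and the same sign as `(σ, λ)` (companion file …TropicalBTranspose), so a UNIQUE optimum must coincide with its
transpose (val-sym-trop-p2's no-tie principle `eq_of_isDominant`, …TropicalBSymmetry):

* `dominant_eq_transpose_of_symmetric` — `(σ⁻¹, λ ∘ σ⁻¹) = (σ, λ)` for every dominant term of a symmetric design;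
* `isInvolution_of_dominant_symmetric` — hence `σ⁻¹ = σ` (`σ * σ = 1`) and the class map is `σ`-invariant,
  `λ (σ j) = λ j`.

Reading: the symmetric tropical census only ever sees involutions — fixed points and 2-cycles, i.e. (partial) MATCHINGS of
the `m` indices with a symmetric class on each matched pair: a parametric NON-bipartite matching count, not an assignment
count.  Every lower-bound family aimed at the symmetric side must consist of involutions. [folklore]
-/

set_option linter.dupNamespace false
set_option autoImplicit false

namespace Summit.ValiantsHypothesis.ValiantsHypothesis.Theorems.KPlusLogSqLaw

open Summit.ValiantsHypothesis.ValiantsHypothesis.Theorems.MatrixDescartes.Negative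
open Summit.ValiantsHypothesis.ValiantsHypothesis.Theorems.LacunarySymmetroidMatrixDescartes
open Summit.ValiantsHypothesis.ValiantsHypothesis.Theorems.LacunarySymmetroidMatrixDescartes.TropicalCensus
open scoped BigOperators
open Finset

section Symmetric

variable {m K : ℕ} (d : Fin K → ℕ) (v ε : Fin m → Fin m → Fin K → ℤ)

/-- **A dominant term of a symmetric design equals its transpose** `(σ⁻¹, λ ∘ σ⁻¹)`. [folklore] -/
theorem dominant_eq_transpose_of_symmetric (hv : ∀ a b l, v b a l = v a b l) (hε : ∀ a b l, ε b a l = ε a b l)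
    (θ : ℤ) (p : Equiv.Perm (Fin m) × (Fin m → Fin K)) (hp : IsDominant d v ε θ p) :
    ((p.1⁻¹ : Equiv.Perm (Fin m)), fun j => p.2 (p.1⁻¹ j)) = p := by
  have hvT : (fun a b l => v b a l) = v := by funext a b l; exact hv a b l
  have hεT : (fun a b l => ε b a l) = ε := by funext a b l; exact hε a b l
  refine eq_of_isDominant d v ε θ hp ?_ (le_of_eq ?_)
  · rw [termSign_transpose, hεT]; exact hp.1
  · rw [tropWeight_transpose, hvT]

/-- **Dominant permutations of a symmetric design are involutions with a `σ`-invariant class map.** [folklore] -/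
theorem isInvolution_of_dominant_symmetric (hv : ∀ a b l, v b a l = v a b l) (hε : ∀ a b l, ε b a l = ε a b l)
    (θ : ℤ) (σ : Equiv.Perm (Fin m)) (μ : Fin m → Fin K) (hp : IsDominant d v ε θ (σ, μ)) :
    σ * σ = 1 ∧ ∀ j, μ (σ j) = μ j := by
  have h := dominant_eq_transpose_of_symmetric d v ε hv hε θ (σ, μ) hp
  simp only [Prod.mk.injEq] at h
  obtain ⟨h1, h2⟩ := h
  refine ⟨?_, fun j => ?_⟩
  · calc σ * σ = σ⁻¹ * σ := by rw [h1]
      _ = 1 := inv_mul_cancel σ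
  · have := congrFun h2 (σ j)
    simp at this
    exact this.symm

/-- In particular every index is a fixed point or lies on a 2-cycle of a dominant permutation of a symmetric design:
`σ (σ j) = j`. [folklore] -/
theorem apply_apply_of_dominant_symmetric (hv : ∀ a b l, v b a l = v a b l) (hε : ∀ a b l, ε b a l = ε a b l)
    (θ : ℤ) (σ : Equiv.Perm (Fin m)) (μ : Fin m → Fin K) (hp : IsDominant d v ε θ (σ, μ)) (j : Fin m) :
    σ (σ j) = j := by
  have h := (isInvolution_of_dominant_symmetric d v ε hv hε θ σ μ hp).1
  have := congrArg (fun τ : Equiv.Perm (Fin m) => τ j) h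
  simpa [Equiv.Perm.mul_apply] using this

end Symmetric

end Summit.ValiantsHypothesis.ValiantsHypothesis.Theorems.KPlusLogSqLaw
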